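import Literature.Analysis.FluidPDE.SteadyNSLiouvilleGreen
import HarnessLib

/-!
# Pointwise interior gradient bounds: Poisson's equation and divergence-free fields

Analysis/FluidPDE support file (theorems only, no definitions, no named facts). The classical
interior gradient estimate for Poisson's equation `Δg = f` (D. Gilbarg, N. S. Trudinger,
*Elliptic partial differential equations of second order* (2001), §3.4, Theorem 3.9 and (3.16):
"`sup_Ω dₓ|Du(x)| ≤ C (sup_Ω |u| + sup_Ω dₓ²|f(x)|)`") in the pointwise, one-ball form

  `‖Dg(x)‖ ≤ C (M / r + r L)`  whenever `|g| ≤ M` and `|Δg| ≤ L` on `B(x, r)`,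

and its consequence for a divergence-free field `v` on `ℝ³` (`Δv = -curl curl v`, so
`|Δvₘ| ≤ ‖curlCLM‖ ‖D(curl v)‖`):

  `‖Dv(x)‖ ≤ C (M / r + r B)`  whenever `‖v‖ ≤ M` and `‖D(curl v)‖ ≤ B` on `B(x, r)`.

The proof is NOT the comparison argument of Gilbarg–Trudinger but the tree's fixed-scale Green
representation `Φ = N[ΔΦ] + Λ[Φ]` (`NewtonLocalPotential.eq_newtonNearPotential_laplacian_add`,
Gilbarg–Trudinger (2.16)–(2.17)) applied to the localisation `Φ = ψ g`, `ψ = ballCutoff x ρ`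
(`= 1` on `B̄(x, 2ρ)`, supported in `B(x, 3ρ)`, `ρ = r/3`), with the derivative of the truncated
Newtonian potential moved onto the kernel (`fderiv_newtonNearPotential_eq_newtonNearGradPotential`,
Gilbarg–Trudinger Lemma 4.1): `∂ₐg(x) = ∫ ∂ₐΓ₀(x − y) ΔΦ(y) dy + ∂ₐΛ[Φ](x)`, where
`|∂ₐΓ₀^{ρ/2,ρ}(z)| ≤ C₁‖a‖|z|⁻²` (`abs_newtonNearGrad_half_le`), `∫_{B(0,ρ)}|z|⁻² dz = 3|B₁|ρ`
(`NewtonPotentialHolder.lintegral_ball_norm_rpow_neg`) and `∫|∂ₐλ_ρ| = ρ⁻¹∫|∂ₐλ₁|`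
(`integral_abs_fderiv_newtonFarLaplacian_half`, `abs_fderiv_newtonFarSmoothing_le_of_abs_le`).

* (private plumbing: `‖L‖ ≤ Σₖ |L eₖ|` for functionals, the localisation `ψ g`, the far term
  `|∂ₐΛ[ψg](x)| ≤ M ρ⁻¹ ∫|∂ₐλ₁|`);
* `abs_fderiv_newtonNearPotential_laplacian_le` — the near term `|∂ₐN[ΔΦ](x)| ≤ C₁‖a‖L·3|B₁|ρ`;
* `abs_fderiv_apply_le_of_laplacian` — `|∂ₐg(x)| ≤ C₁‖a‖L·3|B₁|·(r/3) + M·(r/3)⁻¹∫|∂ₐλ₁|`;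
* `exists_opNorm_fderiv_le_of_laplacian` — **`‖Dg(x)‖ ≤ C (M/r + rL)`** (Gilbarg–Trudinger (3.16));
* `exists_opNorm_fderiv_le_of_isDivFree` — **`‖Dv(x)‖ ≤ C (M/r + rB)`** for divergence-free `v`.

## Mathlib / tree search

Tree (all used): `ballCutoff`, `ballCutoff_mul_eventuallyEq`, `ballCutoff_mul_eq_zero`
(`BallCutoff`); `newtonNearPotential`, `newtonFarSmoothing`, `eq_newtonNearPotential_laplacian_add`,
`contDiff_newtonNearPotential`, `contDiff_newtonFarSmoothing`,
`abs_fderiv_newtonFarSmoothing_le_of_abs_le` (`NewtonLocalPotential`);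
`fderiv_newtonNearPotential_eq_newtonNearGradPotential` (`LocalBiotSavartLog`);
`abs_newtonNearGrad_half_le` (`SteadyNSLiouvilleGreen`); `newtonNearGrad_eq_zero_of_le`
(`NewtonNearDerivatives`); `NewtonPotentialHolder.lintegral_ball_norm_rpow_neg`,
`lintegral_ball_comp_sub_left`; `lamOne`, `lamGradL1`, `integral_abs_fderiv_newtonFarLaplacian_half`,
`laplacian_coord_eq_neg_curl_curl`, `fderiv_apply_coord`, `contDiff_apply_coord`,
`opNorm_le_sum_abs_coord` (`LocalBiotSavartCalculus`); `norm_curl_le` (`TaoEnstrophyLocalisation`);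
`contDiff_laplacian`, `laplacian_eq_zero_of_notMem_tsupport` (`NewtonKernel`). Mathlib:
`laplacian_congr_nhds`, `Filter.EventuallyEq.fderiv_eq`, `enorm_integral_le_lintegral_enorm`.
No pointwise (sup-norm) interior gradient estimate for Poisson's equation was in the tree
(`lean search 'gradient estimate|interior gradient'`: only `L²`/Hölder/log forms,
`LocalBiotSavart.local_biotSavart_bound`, `LocalBiotSavartLog.exists_opNorm_fderiv_le_log`).

## References

* D. Gilbarg, N. S. Trudinger, *Elliptic partial differential equations of second order*,
  Springer (2001), Thm. 3.9 and (3.16); (2.16)–(2.17); Lemma 4.1. [GilbargTrudinger2001]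
* T. Tao, arXiv:1108.1165, §10, proof of Thm. 10.1 (local Biot–Savart law). [Tao2011]
-/

noncomputable section

open MeasureTheory Set Filter Topology Function Metric InnerProductSpace
open scoped ENNReal NNReal RealInnerProductSpace ContDiff Laplacian

namespace Literature.Analysis.FluidPDE

open NewtonPotentialHolder

/-! ### Linear algebra: operator norm of a functional by its entries -/

/-- `‖L‖ ≤ Σₖ |L eₖ|` for a linear functional on `ℝ³`. [folklore] -/
private theorem opNorm_le_sum_abs_coord_real (L : (EuclideanSpace ℝ (Fin 3)) →L[ℝ] ℝ) : ‖L‖ ≤ ∑ k, |L (EuclideanSpace.single k (1 : ℝ))| := by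
  refine ContinuousLinearMap.opNorm_le_bound _ (Finset.sum_nonneg fun k _ => abs_nonneg _) fun v => ?_
  have hv : L v = ∑ k, v k • L (EuclideanSpace.single k (1 : ℝ)) := by
    have hrepr : v = ∑ k, v k • (EuclideanSpace.single k (1 : ℝ)) := by
      simpa using ((EuclideanSpace.basisFun (Fin 3) ℝ).sum_repr v).symm
    conv_lhs => rw [hrepr]
    simp [map_sum, map_smul]
  have hvk : ∀ k, |v k| ≤ ‖v‖ := fun k => by
    simpa [Real.norm_eq_abs] using PiLp.norm_apply_le v k
  calc ‖L v‖ = ‖∑ k, v k • L (EuclideanSpace.single k (1 : ℝ))‖ := by rw [hv]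
    _ ≤ ∑ k, ‖v k • L (EuclideanSpace.single k (1 : ℝ))‖ := norm_sum_le _ _
    _ = ∑ k, |v k| * |L (EuclideanSpace.single k (1 : ℝ))| := by simp [Real.norm_eq_abs]
    _ ≤ ∑ k, ‖v‖ * |L (EuclideanSpace.single k (1 : ℝ))| := Finset.sum_le_sum fun k _ =>
        mul_le_mul_of_nonneg_right (hvk k) (abs_nonneg _)
    _ = (∑ k, |L (EuclideanSpace.single k (1 : ℝ))|) * ‖v‖ := by rw [← Finset.mul_sum, mul_comm]

/-! ### The localisation `Φ = ψ g` -/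

section Cutoff

variable {g : (EuclideanSpace ℝ (Fin 3)) → ℝ} {x : (EuclideanSpace ℝ (Fin 3))} {ρ : ℝ}

/-- `Φ = ψ g` is `Cⁿ` when `g` is. [folklore] -/
private theorem contDiff_ballCutoff_mul {n : ℕ} (hg : ContDiff ℝ n g) (x : (EuclideanSpace ℝ (Fin 3))) (ρ : ℝ) :
    ContDiff ℝ n fun y => ballCutoff x ρ y * g y :=
  (contDiff_ballCutoff x ρ (n := n)).mul hg

/-- `Φ = ψ g` has compact support. [folklore] -/
private theorem hasCompactSupport_ballCutoff_mul (hρ : 0 < ρ) (g : (EuclideanSpace ℝ (Fin 3)) → ℝ) (x : (EuclideanSpace ℝ (Fin 3))) :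
    HasCompactSupport fun y => ballCutoff x ρ y * g y :=
  (hasCompactSupport_ballCutoff (c := x) hρ).mul_right

/-- `|Φ| ≤ M` everywhere when `|g| ≤ M` on the support ball `B(x, 3ρ)`. [folklore] -/
private theorem abs_ballCutoff_mul_le (hρ : 0 < ρ) {M : ℝ} (hM : ∀ y ∈ ball x (3 * ρ), |g y| ≤ M)
    (y : (EuclideanSpace ℝ (Fin 3))) : |ballCutoff x ρ y * g y| ≤ M := by
  have hM0 : 0 ≤ M := (abs_nonneg _).trans (hM x (mem_ball_self (by positivity)))
  by_cases hy : y ∈ ball x (3 * ρ)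
  · rw [abs_mul]
    calc |ballCutoff x ρ y| * |g y| ≤ 1 * |g y| :=
          mul_le_mul_of_nonneg_right (abs_ballCutoff_le_one x ρ y) (abs_nonneg _)
      _ ≤ M := by rw [one_mul]; exact hM y hy
  · rw [ballCutoff_mul_eq_zero hρ g hy, abs_zero]
    exact hM0

/-- The Laplacian of a compactly supported function has compact support. [folklore] -/
private theorem hasCompactSupport_laplacian_real {φ : (EuclideanSpace ℝ (Fin 3)) → ℝ} (hc : HasCompactSupport φ) :
    HasCompactSupport (Δ φ) :=
  hc.mono' fun x hx => by
    by_contra h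
    exact hx (laplacian_eq_zero_of_notMem_tsupport h)

/-- On `B(x, 2ρ)` the Laplacian of `Φ = ψ g` is that of `g`. [folklore] -/
private theorem laplacian_ballCutoff_mul_eq (hρ : 0 < ρ) (g : (EuclideanSpace ℝ (Fin 3)) → ℝ) {y : (EuclideanSpace ℝ (Fin 3))} (hy : y ∈ ball x (2 * ρ)) :
    (Δ fun z => ballCutoff x ρ z * g z) y = (Δ g) y :=
  (laplacian_congr_nhds (ballCutoff_mul_eventuallyEq hρ g hy)).eq_of_nhds

end Cutoff

/-! ### The near term: the gradient potential of `ΔΦ` -/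

section Near

variable {x : (EuclideanSpace ℝ (Fin 3))} {ρ L : ℝ}

/-- Pointwise majorant of the gradient-potential integrand: on `B(x, ρ)` it is at most
`C₁‖a‖L · |x − y|⁻²`, and it vanishes off that ball. [folklore] -/
private theorem enorm_newtonNearGrad_smul_le_indicator {C₁ : ℝ} (hC₁0 : 0 ≤ C₁)
    (hC₁ : ∀ ⦃r : ℝ⦄, 0 < r → ∀ a z : (EuclideanSpace ℝ (Fin 3)), |newtonNearGrad (r / 2) r a z| ≤ C₁ * ‖a‖ * ‖z‖ ^ (-(2 : ℝ)))
    (hρ : 0 < ρ) {f : (EuclideanSpace ℝ (Fin 3)) → ℝ} (hL : ∀ y ∈ ball x ρ, |f y| ≤ L) (a y : (EuclideanSpace ℝ (Fin 3))) :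
    ‖newtonNearGrad (ρ / 2) ρ a (x - y) • f y‖ₑ ≤
      (ball x ρ).indicator
        (fun y => ENNReal.ofReal (C₁ * ‖a‖ * L) * ENNReal.ofReal (‖x - y‖ ^ (-(2 : ℝ)))) y := by
  by_cases hy : y ∈ ball x ρ
  · have hk := hC₁ hρ a (x - y)
    have hCa : 0 ≤ C₁ * ‖a‖ := mul_nonneg hC₁0 (norm_nonneg _)
    rw [indicator_of_mem hy, enorm_smul, Real.enorm_eq_ofReal_abs, Real.enorm_eq_ofReal_abs]
    calc ENNReal.ofReal |newtonNearGrad (ρ / 2) ρ a (x - y)| * ENNReal.ofReal |f y|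
        ≤ ENNReal.ofReal (C₁ * ‖a‖ * ‖x - y‖ ^ (-(2 : ℝ))) * ENNReal.ofReal L :=
          mul_le_mul' (ENNReal.ofReal_le_ofReal hk) (ENNReal.ofReal_le_ofReal (hL y hy))
      _ = ENNReal.ofReal (C₁ * ‖a‖ * L) * ENNReal.ofReal (‖x - y‖ ^ (-(2 : ℝ))) := by
          rw [ENNReal.ofReal_mul hCa, ENNReal.ofReal_mul hCa]
          ring
  · rw [indicator_of_notMem hy]
    rw [mem_ball, dist_comm, dist_eq_norm, not_lt] at hy
    rw [newtonNearGrad_eq_zero_of_le (half_pos hρ) (half_lt_self hρ) a hy, zero_smul, enorm_zero]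

/-- `∫_{B(x,ρ)} |x − y|⁻² dy = 3 |B₁| ρ`. [folklore] -/
private theorem lintegral_ball_norm_sub_rpow_neg_two (x : (EuclideanSpace ℝ (Fin 3))) (hρ : 0 < ρ) :
    ∫⁻ y in ball x ρ, ENNReal.ofReal (‖x - y‖ ^ (-(2 : ℝ))) =
      ENNReal.ofReal (3 * (volume : Measure (EuclideanSpace ℝ (Fin 3))).real (ball 0 1) * ρ) := by
  rw [lintegral_ball_comp_sub_left (fun z => ENNReal.ofReal (‖z‖ ^ (-(2 : ℝ)))) x ρ,
    lintegral_ball_norm_rpow_neg (by norm_num) hρ]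
  congr 1
  rw [show (3 : ℝ) - 2 = 1 by norm_num, Real.rpow_one, div_one]

/-- **The near term.** For `Φ ∈ C³` with compact support and `|ΔΦ| ≤ L` on `B(x, ρ)`:
`|∂ₐN[ΔΦ](x)| ≤ C₁ ‖a‖ L · 3|B₁| ρ` (`N = newtonNearPotential (ρ/2) ρ`). [cite: GilbargTrudinger2001, Lemma 4.1] -/
theorem abs_fderiv_newtonNearPotential_laplacian_le {C₁ : ℝ} (hC₁0 : 0 ≤ C₁)
    (hC₁ : ∀ ⦃r : ℝ⦄, 0 < r → ∀ a z : (EuclideanSpace ℝ (Fin 3)), |newtonNearGrad (r / 2) r a z| ≤ C₁ * ‖a‖ * ‖z‖ ^ (-(2 : ℝ)))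
    {φ : (EuclideanSpace ℝ (Fin 3)) → ℝ} (hφ : ContDiff ℝ 3 φ) (hφc : HasCompactSupport φ) (hρ : 0 < ρ)
    (hL : ∀ y ∈ ball x ρ, |(Δ φ) y| ≤ L) (a : (EuclideanSpace ℝ (Fin 3))) :
    |fderiv ℝ (newtonNearPotential (ρ / 2) ρ (Δ φ)) x a| ≤
      C₁ * ‖a‖ * L * (3 * (volume : Measure (EuclideanSpace ℝ (Fin 3))).real (ball 0 1) * ρ) := by
  have h₀ : 0 < ρ / 2 := half_pos hρ
  have h₁ : ρ / 2 < ρ := half_lt_self hρ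
  have hΔ1 : ContDiff ℝ 1 (Δ φ) := contDiff_laplacian (n := 1) (by exact hφ)
  have hΔc : HasCompactSupport (Δ φ) := hasCompactSupport_laplacian_real hφc
  have hL0 : 0 ≤ L := (abs_nonneg _).trans (hL x (mem_ball_self hρ))
  have hR0 : 0 ≤ C₁ * ‖a‖ * L * (3 * (volume : Measure (EuclideanSpace ℝ (Fin 3))).real (ball 0 1) * ρ) := by positivity
  rw [fderiv_newtonNearPotential_eq_newtonNearGradPotential h₀ h₁ hΔ1 hΔc x a]
  unfold newtonNearGradPotential
  have key : ‖∫ y, newtonNearGrad (ρ / 2) ρ a (x - y) • (Δ φ) y‖ₑ ≤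
      ENNReal.ofReal (C₁ * ‖a‖ * L * (3 * (volume : Measure (EuclideanSpace ℝ (Fin 3))).real (ball 0 1) * ρ)) := by
    calc ‖∫ y, newtonNearGrad (ρ / 2) ρ a (x - y) • (Δ φ) y‖ₑ
        ≤ ∫⁻ y, ‖newtonNearGrad (ρ / 2) ρ a (x - y) • (Δ φ) y‖ₑ := enorm_integral_le_lintegral_enorm _
      _ ≤ ∫⁻ y, (ball x ρ).indicator
            (fun y => ENNReal.ofReal (C₁ * ‖a‖ * L) * ENNReal.ofReal (‖x - y‖ ^ (-(2 : ℝ)))) y :=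
          lintegral_mono fun y => enorm_newtonNearGrad_smul_le_indicator hC₁0 hC₁ hρ hL a y
      _ = ∫⁻ y in ball x ρ, ENNReal.ofReal (C₁ * ‖a‖ * L) * ENNReal.ofReal (‖x - y‖ ^ (-(2 : ℝ))) :=
          lintegral_indicator measurableSet_ball _
      _ = ENNReal.ofReal (C₁ * ‖a‖ * L) * ∫⁻ y in ball x ρ, ENNReal.ofReal (‖x - y‖ ^ (-(2 : ℝ))) :=
          lintegral_const_mul' _ _ ENNReal.ofReal_ne_top
      _ = ENNReal.ofReal (C₁ * ‖a‖ * L) * ENNReal.ofReal (3 * (volume : Measure (EuclideanSpace ℝ (Fin 3))).real (ball 0 1) * ρ) := by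
          rw [lintegral_ball_norm_sub_rpow_neg_two x hρ]
      _ = ENNReal.ofReal (C₁ * ‖a‖ * L * (3 * (volume : Measure (EuclideanSpace ℝ (Fin 3))).real (ball 0 1) * ρ)) := by
          rw [← ENNReal.ofReal_mul (by positivity)]
  rw [← Real.norm_eq_abs, ← ENNReal.ofReal_le_ofReal_iff hR0, ofReal_norm]
  exact key

end Near

/-! ### The far term: the smoothing remainder -/

section Far

variable {g : (EuclideanSpace ℝ (Fin 3)) → ℝ} {x : (EuclideanSpace ℝ (Fin 3))} {ρ M : ℝ}

/-- **The far term.** If `|g| ≤ M` on `B(x, 3ρ)` then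
`|∂ₐΛ[ψ g](x)| ≤ M ρ⁻¹ ∫ |∂ₐλ₁|` (`Λ = newtonFarSmoothing (ρ/2) ρ`, `λ₁ = lamOne`). [folklore] -/
private theorem abs_fderiv_newtonFarSmoothing_cutoff_le (hg : Continuous g) (hρ : 0 < ρ)
    (hM : ∀ y ∈ ball x (3 * ρ), |g y| ≤ M) (a : (EuclideanSpace ℝ (Fin 3))) :
    |fderiv ℝ (newtonFarSmoothing (ρ / 2) ρ (fun y => ballCutoff x ρ y * g y)) x a| ≤
      M * (ρ⁻¹ * ∫ z, |fderiv ℝ lamOne z a|) := by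
  have hφc : Continuous fun y => ballCutoff x ρ y * g y :=
    (contDiff_ballCutoff x ρ (n := 0)).continuous.mul hg
  rw [← integral_abs_fderiv_newtonFarLaplacian_half hρ a]
  exact abs_fderiv_newtonFarSmoothing_le_of_abs_le (half_pos hρ) (half_lt_self hρ) hφc
    (hasCompactSupport_ballCutoff_mul hρ g x) (abs_ballCutoff_mul_le hρ hM) x a

end Far

/-! ### The pointwise gradient bound for Poisson's equation -/

section Poisson

variable {g : (EuclideanSpace ℝ (Fin 3)) → ℝ} {x : (EuclideanSpace ℝ (Fin 3))} {r M L : ℝ}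

/-- **Directional form.** For `g ∈ C³(ℝ³)` with `|g| ≤ M` and `|Δg| ≤ L` on `B(x, r)`, and
the absolute kernel constant `C₁` of `abs_newtonNearGrad_half_le`:
`|∂ₐg(x)| ≤ C₁‖a‖L · 3|B₁| · (r/3) + M (r/3)⁻¹ ∫|∂ₐλ₁|`. [cite: GilbargTrudinger2001, Thm. 3.9 / (3.16)] -/
theorem abs_fderiv_apply_le_of_laplacian {C₁ : ℝ} (hC₁0 : 0 ≤ C₁)
    (hC₁ : ∀ ⦃r : ℝ⦄, 0 < r → ∀ a z : (EuclideanSpace ℝ (Fin 3)), |newtonNearGrad (r / 2) r a z| ≤ C₁ * ‖a‖ * ‖z‖ ^ (-(2 : ℝ)))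
    (hg : ContDiff ℝ 3 g) (hr : 0 < r) (hM : ∀ y ∈ ball x r, |g y| ≤ M)
    (hL : ∀ y ∈ ball x r, |(Δ g) y| ≤ L) (a : (EuclideanSpace ℝ (Fin 3))) :
    |fderiv ℝ g x a| ≤
      C₁ * ‖a‖ * L * (3 * (volume : Measure (EuclideanSpace ℝ (Fin 3))).real (ball 0 1) * (r / 3)) +
        M * ((r / 3)⁻¹ * ∫ z, |fderiv ℝ lamOne z a|) := by
  -- the localisation at scale `ρ = r/3`
  set ρ : ℝ := r / 3 with hρdef
  have hρ : 0 < ρ := by positivity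
  have h₀ : 0 < ρ / 2 := half_pos hρ
  have h₁ : ρ / 2 < ρ := half_lt_self hρ
  have h3ρ : 3 * ρ = r := by rw [hρdef]; ring
  set φ : (EuclideanSpace ℝ (Fin 3)) → ℝ := fun y => ballCutoff x ρ y * g y with hφdef
  have hφ3 : ContDiff ℝ 3 φ := contDiff_ballCutoff_mul (n := 3) hg x ρ
  have hφ2 : ContDiff ℝ 2 φ := hφ3.of_le (by norm_num)
  have hφ1 : ContDiff ℝ 1 φ := hφ3.of_le (by norm_num)
  have hφc : HasCompactSupport φ := hasCompactSupport_ballCutoff_mul hρ g x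
  have hΔ1 : ContDiff ℝ 1 (Δ φ) := contDiff_laplacian (n := 1) (by exact hφ3)
  -- Green's representation `Φ = N[ΔΦ] + Λ[Φ]`
  have hrep : φ = fun y => newtonNearPotential (ρ / 2) ρ (Δ φ) y + newtonFarSmoothing (ρ / 2) ρ φ y :=
    funext fun y => eq_newtonNearPotential_laplacian_add h₀ h₁ hφ2 y
  have hN : Differentiable ℝ (newtonNearPotential (ρ / 2) ρ (Δ φ)) :=
    (contDiff_newtonNearPotential h₀.le h₁ 1 hΔ1).differentiable one_ne_zero
  have hΛ : Differentiable ℝ (newtonFarSmoothing (ρ / 2) ρ φ) :=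
    (contDiff_newtonFarSmoothing h₀ h₁ 1 hφ1).differentiable one_ne_zero
  -- `∂ₐg(x) = ∂ₐΦ(x) = ∂ₐN[ΔΦ](x) + ∂ₐΛ[Φ](x)`
  have hx2 : x ∈ ball x (2 * ρ) := mem_ball_self (by positivity)
  have hgφ : fderiv ℝ g x a = fderiv ℝ (newtonNearPotential (ρ / 2) ρ (Δ φ)) x a +
      fderiv ℝ (newtonFarSmoothing (ρ / 2) ρ φ) x a := by
    have h1 : fderiv ℝ g x = fderiv ℝ φ x := ((ballCutoff_mul_eventuallyEq hρ g hx2).fderiv_eq).symm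
    have h2 : fderiv ℝ φ x = fderiv ℝ (fun y => newtonNearPotential (ρ / 2) ρ (Δ φ) y +
        newtonFarSmoothing (ρ / 2) ρ φ y) x := congrArg (fun F : (EuclideanSpace ℝ (Fin 3)) → ℝ => fderiv ℝ F x) hrep
    rw [h1, h2]
    show fderiv ℝ (newtonNearPotential (ρ / 2) ρ (Δ φ) + newtonFarSmoothing (ρ / 2) ρ φ) x a = _
    rw [fderiv_add (hN x) (hΛ x)]
    rfl
  -- bounds on the data at scale `ρ`
  have hLρ : ∀ y ∈ ball x ρ, |(Δ φ) y| ≤ L := by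
    intro y hy
    have hy2 : y ∈ ball x (2 * ρ) := ball_subset_ball (by linarith) hy
    have hyr : y ∈ ball x r := ball_subset_ball (by linarith) hy
    rw [hφdef, laplacian_ballCutoff_mul_eq hρ g hy2]
    exact hL y hyr
  have hMρ : ∀ y ∈ ball x (3 * ρ), |g y| ≤ M := fun y hy => hM y (h3ρ ▸ hy)
  rw [hgφ]
  calc |fderiv ℝ (newtonNearPotential (ρ / 2) ρ (Δ φ)) x a + fderiv ℝ (newtonFarSmoothing (ρ / 2) ρ φ) x a|
      ≤ |fderiv ℝ (newtonNearPotential (ρ / 2) ρ (Δ φ)) x a| + |fderiv ℝ (newtonFarSmoothing (ρ / 2) ρ φ) x a| :=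
        abs_add_le _ _
    _ ≤ C₁ * ‖a‖ * L * (3 * (volume : Measure (EuclideanSpace ℝ (Fin 3))).real (ball 0 1) * ρ) +
          M * (ρ⁻¹ * ∫ z, |fderiv ℝ lamOne z a|) :=
        add_le_add (abs_fderiv_newtonNearPotential_laplacian_le hC₁0 hC₁ hφ3 hφc hρ hLρ a)
          (abs_fderiv_newtonFarSmoothing_cutoff_le hg.continuous hρ hMρ a)

/-- **Interior gradient estimate for Poisson's equation, pointwise form** (Gilbarg–Trudinger
(3.16) on one ball): there is an absolute constant `C` such that for every `g ∈ C³(ℝ³)`, every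
`x`, every `r > 0` and all `M, L` with `|g| ≤ M` and `|Δg| ≤ L` on `B(x, r)`,
`‖Dg(x)‖ ≤ C (M / r + r L)`. [cite: GilbargTrudinger2001, Thm. 3.9 / (3.16)] -/
theorem exists_opNorm_fderiv_le_of_laplacian :
    ∃ C : ℝ, 0 < C ∧ ∀ (g : (EuclideanSpace ℝ (Fin 3)) → ℝ) (x : (EuclideanSpace ℝ (Fin 3))) (r M L : ℝ), ContDiff ℝ 3 g → 0 < r →
      (∀ y ∈ ball x r, |g y| ≤ M) → (∀ y ∈ ball x r, |(Δ g) y| ≤ L) →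
      ‖fderiv ℝ g x‖ ≤ C * (M / r + r * L) := by
  obtain ⟨C₁, hC₁0, hC₁⟩ := abs_newtonNearGrad_half_le
  set cB : ℝ := 3 * (volume : Measure (EuclideanSpace ℝ (Fin 3))).real (ball 0 1) with hcB
  have hcB0 : 0 ≤ cB := by positivity
  refine ⟨max (C₁ * cB) (3 * lamGradL1) + 1, by positivity, ?_⟩
  intro g x r M L hg hr hM hL
  have hM0 : 0 ≤ M := (abs_nonneg _).trans (hM x (mem_ball_self hr))
  have hL0 : 0 ≤ L := (abs_nonneg _).trans (hL x (mem_ball_self hr))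
  have hone : ∀ k : Fin 3, ‖(EuclideanSpace.single k (1 : ℝ) : (EuclideanSpace ℝ (Fin 3)))‖ = 1 := fun k => by simp
  -- sum of the three directional bounds
  have hsum : ∑ k : Fin 3, |fderiv ℝ g x (EuclideanSpace.single k (1 : ℝ))| ≤
      ∑ k : Fin 3, (C₁ * L * (cB * (r / 3)) + M * ((r / 3)⁻¹ * ∫ z, |fderiv ℝ lamOne z (EuclideanSpace.single k (1 : ℝ))|)) := by
    refine Finset.sum_le_sum fun k _ => ?_
    have h := abs_fderiv_apply_le_of_laplacian hC₁0 hC₁ hg hr hM hL (EuclideanSpace.single k (1 : ℝ))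
    rw [hone k, mul_one] at h
    calc |fderiv ℝ g x (EuclideanSpace.single k (1 : ℝ))| ≤ _ := h
      _ = C₁ * L * (cB * (r / 3)) + M * ((r / 3)⁻¹ * ∫ z, |fderiv ℝ lamOne z (EuclideanSpace.single k (1 : ℝ))|) := by
          rw [hcB]
  have hsum' : ∑ k : Fin 3, (C₁ * L * (cB * (r / 3)) + M * ((r / 3)⁻¹ * ∫ z, |fderiv ℝ lamOne z (EuclideanSpace.single k (1 : ℝ))|)) =
      C₁ * cB * (r * L) + 3 * lamGradL1 * (M / r) := by
    rw [Finset.sum_add_distrib, Finset.sum_const, Finset.card_univ, Fintype.card_fin,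
      nsmul_eq_mul, Nat.cast_ofNat, ← Finset.mul_sum, ← Finset.mul_sum, lamGradL1]
    field_simp
  calc ‖fderiv ℝ g x‖ ≤ ∑ k : Fin 3, |fderiv ℝ g x (EuclideanSpace.single k (1 : ℝ))| := opNorm_le_sum_abs_coord_real _
    _ ≤ C₁ * cB * (r * L) + 3 * lamGradL1 * (M / r) := hsum'.symm ▸ hsum
    _ ≤ (max (C₁ * cB) (3 * lamGradL1) + 1) * (r * L) + (max (C₁ * cB) (3 * lamGradL1) + 1) * (M / r) := by
        have hK1 : C₁ * cB ≤ max (C₁ * cB) (3 * lamGradL1) + 1 := by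
          linarith [le_max_left (C₁ * cB) (3 * lamGradL1)]
        have hK2 : 3 * lamGradL1 ≤ max (C₁ * cB) (3 * lamGradL1) + 1 := by
          linarith [le_max_right (C₁ * cB) (3 * lamGradL1)]
        exact add_le_add (mul_le_mul_of_nonneg_right hK1 (mul_nonneg hr.le hL0))
          (mul_le_mul_of_nonneg_right hK2 (div_nonneg hM0 hr.le))
    _ = (max (C₁ * cB) (3 * lamGradL1) + 1) * (M / r + r * L) := by ring

end Poisson

/-! ### Divergence-free fields: `‖Dv(x)‖ ≤ C (M / r + r ‖D curl v‖_∞)` -/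

section DivFree

variable {v : (EuclideanSpace ℝ (Fin 3)) → (EuclideanSpace ℝ (Fin 3))} {x : (EuclideanSpace ℝ (Fin 3))} {r M B : ℝ}

/-- For a divergence-free `C²` field, `|Δvₘ(y)| ≤ ‖curlCLM‖ ‖D(curl v)(y)‖`
(`Δv = -curl curl v`). [cite: MajdaBertozziCUP2002, Prop. 2.16 (proof)] -/
theorem abs_laplacian_coord_le_of_isDivFree (hv : ContDiff ℝ 2 v) (hdiv : VectorCalculus.IsDivFree v)
    (y : (EuclideanSpace ℝ (Fin 3))) (m : Fin 3) :
    |(Δ fun z => v z m) y| ≤ ‖curlCLM‖ * ‖fderiv ℝ (curl v) y‖ := by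
  rw [laplacian_coord_eq_neg_curl_curl hv hdiv y m, abs_neg]
  calc |curl (curl v) y m| = ‖curl (curl v) y m‖ := (Real.norm_eq_abs _).symm
    _ ≤ ‖curl (curl v) y‖ := PiLp.norm_apply_le (curl (curl v) y) m
    _ ≤ ‖curlCLM‖ * ‖fderiv ℝ (curl v) y‖ := norm_curl_le (curl v) y

/-- **Pointwise gradient bound for divergence-free fields.** There is an absolute constant `C`
such that for every divergence-free `v ∈ C³(ℝ³; ℝ³)`, every `x`, every `r > 0` and all `M, B`
with `‖v‖ ≤ M` and `‖D(curl v)‖ ≤ B` on `B(x, r)`: `‖Dv(x)‖ ≤ C (M / r + r B)` — far vorticity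
enters only through the velocity bound, near vorticity only through one derivative of `curl v`.
[cite: GilbargTrudinger2001, Thm. 3.9 / (3.16)] -/
theorem exists_opNorm_fderiv_le_of_isDivFree :
    ∃ C : ℝ, 0 < C ∧ ∀ (v : (EuclideanSpace ℝ (Fin 3)) → (EuclideanSpace ℝ (Fin 3))) (x : (EuclideanSpace ℝ (Fin 3))) (r M B : ℝ), ContDiff ℝ 3 v →
      VectorCalculus.IsDivFree v → 0 < r →
      (∀ y ∈ ball x r, ‖v y‖ ≤ M) → (∀ y ∈ ball x r, ‖fderiv ℝ (curl v) y‖ ≤ B) →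
      ‖fderiv ℝ v x‖ ≤ C * (M / r + r * B) := by
  obtain ⟨C, hC, hCg⟩ := exists_opNorm_fderiv_le_of_laplacian
  refine ⟨9 * C * (‖curlCLM‖ + 1), by positivity, ?_⟩
  intro v x r M B hv hdiv hr hM hB
  have hv2 : ContDiff ℝ 2 v := hv.of_le (by norm_num)
  have hv1 : ContDiff ℝ 1 v := hv.of_le (by norm_num)
  have hM0 : 0 ≤ M := (norm_nonneg _).trans (hM x (mem_ball_self hr))
  have hB0 : 0 ≤ B := (norm_nonneg _).trans (hB x (mem_ball_self hr))
  -- each component `vₘ` solves `|Δvₘ| ≤ ‖curlCLM‖ B` on the ball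
  have hcomp : ∀ m : Fin 3, ‖fderiv ℝ (fun z => v z m) x‖ ≤ C * (M / r + r * (‖curlCLM‖ * B)) := by
    intro m
    refine hCg (fun z => v z m) x r M (‖curlCLM‖ * B) (contDiff_apply_coord hv m) hr ?_ ?_
    · intro y hy
      calc |v y m| = ‖v y m‖ := (Real.norm_eq_abs _).symm
        _ ≤ ‖v y‖ := PiLp.norm_apply_le (v y) m
        _ ≤ M := hM y hy
    · intro y hy
      calc |(Δ fun z => v z m) y| ≤ ‖curlCLM‖ * ‖fderiv ℝ (curl v) y‖ :=
            abs_laplacian_coord_le_of_isDivFree hv2 hdiv y m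
        _ ≤ ‖curlCLM‖ * B := mul_le_mul_of_nonneg_left (hB y hy) (ContinuousLinearMap.opNorm_nonneg curlCLM)
  -- entries of `Dv(x)` are entries of the component derivatives
  have hentry : ∀ k m : Fin 3, |fderiv ℝ v x (EuclideanSpace.single k (1 : ℝ)) m| ≤ C * (M / r + r * (‖curlCLM‖ * B)) := by
    intro k m
    rw [← fderiv_apply_coord (hv1.differentiable one_ne_zero x) (EuclideanSpace.single k (1 : ℝ)) m]
    calc |fderiv ℝ (fun z => v z m) x (EuclideanSpace.single k (1 : ℝ))| = ‖fderiv ℝ (fun z => v z m) x (EuclideanSpace.single k (1 : ℝ))‖ := (Real.norm_eq_abs _).symm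
      _ ≤ ‖fderiv ℝ (fun z => v z m) x‖ * ‖(EuclideanSpace.single k (1 : ℝ) : (EuclideanSpace ℝ (Fin 3)))‖ := ContinuousLinearMap.le_opNorm _ _
      _ = ‖fderiv ℝ (fun z => v z m) x‖ := by simp
      _ ≤ C * (M / r + r * (‖curlCLM‖ * B)) := hcomp m
  calc ‖fderiv ℝ v x‖ ≤ ∑ k, ∑ m, |fderiv ℝ v x (EuclideanSpace.single k (1 : ℝ)) m| := opNorm_le_sum_abs_coord _
    _ ≤ ∑ _k : Fin 3, ∑ _m : Fin 3, C * (M / r + r * (‖curlCLM‖ * B)) :=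
        Finset.sum_le_sum fun k _ => Finset.sum_le_sum fun m _ => hentry k m
    _ = 9 * (C * (M / r + r * (‖curlCLM‖ * B))) := by
        simp only [Finset.sum_const, Finset.card_univ, Fintype.card_fin, nsmul_eq_mul, Nat.cast_ofNat]
        ring
    _ ≤ 9 * C * (‖curlCLM‖ + 1) * (M / r + r * B) := by
        have h1 : 0 ≤ M / r := div_nonneg hM0 hr.le
        have h2 : 0 ≤ r * B := mul_nonneg hr.le hB0
        have h3 : 0 ≤ ‖curlCLM‖ := ContinuousLinearMap.opNorm_nonneg curlCLM
        nlinarith [mul_nonneg hC.le h1, mul_nonneg hC.le h2, mul_nonneg (mul_nonneg hC.le h2) h3,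
          mul_nonneg (mul_nonneg hC.le h1) h3]

end DivFree

end Literature.Analysis.FluidPDE
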